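import Summits.BirchSwinnertonDyer.Rank1Residual.Iwasawa.LambdaInvariantZeroSetLayers
import Mathlib.RingTheory.PrincipalIdealDomain
import HarnessLib

/-!
# Budget zero ⇒ the divisor is known: if `λ(G) = r + Σ_{n∈S} φ(pⁿ⁺¹)` then the distinguished polynomial
# of `G` IS `X^r · ∏_{n∈S} Φ_{pⁿ⁺¹}(X+1)`, i.e. `G = p^μ · T^r · ∏ Φ_{pⁿ⁺¹}(1+T) · (unit of Λ)`
# (cell `b2b-bsdres`; class-agnostic kernel support for the (μ, λ) censuses; prover unit
# `b2b-bsdres-additive-p3`, gen 8)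

HONEST FRAMING (run/shared/lean/b2b/bsd-rank1-residual/, verbatim in every file): the goal of the
cell is to DELETE the COMBINATION-SHAPED residual classes of the Birch–Swinnerton-Dyer formula for
ALL analytic-rank `≤ 1` elliptic curves over `ℚ` — "full BSD formula for every rank `≤ 1` curve in
class `C`" assembled STRICTLY from published theorems — so that the rank-`≤ 1` remainder becomes
exactly the CONSTRUCTION-SHAPED classes, which are TYPED (missing-input `Prop`s), NOT attempted.
This is not "finishing BSD". THEOREMS ONLY (pure `p`-adic algebra); no named fact; nothing about any
curve is asserted; nothing booked; no label changes.

## What this file proves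

The vanishing-conductor census (`HOME/b2b-bsdres-additive-p3/VANISHING-CONDUCTORS.md`, gen 8) finds
`budget = λ − r − Σ_{k∈CZ} φ(p^k) = 0` on 1 033 of the 3 958 (curve, p) pairs: every zero of the
`p`-adic `L`-function in the open unit disc is at `T = 0` or at a cyclotomic point. This file is the
kernel statement of what that means (Washington §7.1–7.2: `λ` counts the zeros, so there is no room
left in the distinguished polynomial):

* §1 algebra in `ℚ_p[X]`: `X` and the `Φ_{pⁿ⁺¹}(X+1)` are pairwise coprime
  (`isCoprime_X_cyclotomic_comp`, `isCoprime_cyclotomic_comp_of_ne` — distinct monic irreducibles of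
  different degrees), so `X^r · ∏_{n∈S} Φ_{pⁿ⁺¹}(X+1)` divides any polynomial each factor divides
  (`X_pow_mul_prod_cyclotomic_dvd`).
* §2 **`weierstrassDistinguished_eq_of_lam_eq`**: for `G = p^m · G'`, `G' ≢ 0 (mod p)`, `P` the
  distinguished polynomial of `G'`: if `T^r ∣ G`, `G` vanishes at some `ζ_n − 1` of order `pⁿ⁺¹`
  for every `n ∈ S`, and `λ(G) = r + Σ_{n∈S} φ(pⁿ⁺¹)`, then `P = X^r · ∏_{n∈S} Φ_{pⁿ⁺¹}(X+1)`; hence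
  **`eq_C_mul_prod_mul_weierstrassUnit_of_lam_eq`**: `G = C(p^m) · (X^r ∏ Φ_{pⁿ⁺¹}(X+1)) · U` with
  `U` the Weierstrass unit — the element is determined by `(m, r, S)` up to a unit of `Λ`; and
  `hasSum_zero_iff_of_lam_eq`: its zeros in the open unit disc are EXACTLY `0` (if `r ≥ 1`) and the
  `ζ − 1` with `ζ` of order `pⁿ⁺¹`, `n ∈ S`.

Arithmetic reading (no new arithmetic input): at a census row with budget `0`, e.g. `91b1@3`
(`r = 1`, `CZ = {1, 2}` in the census numbering, `λ = 9 = 1 + 2 + 6`), the integral model of the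
`p`-adic `L`-function is `T · Φ_3(1+T) · Φ_9(1+T) · (unit)`; under the main conjecture this is the
characteristic ideal of the dual Selmer group on the nose.

References: [Washington1997] §7.1–7.2 (Thm. 7.3); HOME/b2b-bsdres-additive-p3/X8-ROUTE-B.md §13 (gen 8).
-/

set_option autoImplicit false

noncomputable section

open scoped Classical

open Polynomial Literature.NumberTheory.EllipticCurves
  Summit.BirchSwinnertonDyer.Rank1Residual.X1.MuLambda

namespace Summit.BirchSwinnertonDyer.Rank1Residual.Iwasawa

variable {p : ℕ} [hp : Fact p.Prime]

/-! ## §1. Coprimality of `X` and the shifted cyclotomic polynomials in `ℚ_p[X]` -/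

section Coprime

/-- `X` and `Φ_{pⁿ⁺¹}(X+1)` are coprime in `ℚ_p[X]` (`Φ_{pⁿ⁺¹}(1) = p ≠ 0`). [folklore] -/
theorem isCoprime_X_cyclotomic_comp (n : ℕ) :
    IsCoprime (X : ℚ_[p][X]) ((cyclotomic (p ^ (n + 1)) ℚ_[p]).comp (X + 1)) := by
  rw [(irreducible_X (R := ℚ_[p])).coprime_iff_not_dvd, X_dvd_iff, coeff_zero_eq_eval_zero, eval_comp,
    eval_add, eval_X, eval_one, zero_add, eval_one_cyclotomic_prime_pow]
  exact Nat.cast_ne_zero.mpr hp.out.ne_zero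

/-- `Φ_{p^{a+1}}(X+1)` and `Φ_{p^{b+1}}(X+1)` are coprime in `ℚ_p[X]` for `a ≠ b` (distinct monic
irreducibles — p220367 — of different degrees `φ(p^{a+1}) ≠ φ(p^{b+1})`). [folklore] -/
theorem isCoprime_cyclotomic_comp_of_ne {a b : ℕ} (hab : a ≠ b) :
    IsCoprime ((cyclotomic (p ^ (a + 1)) ℚ_[p]).comp (X + 1))
      ((cyclotomic (p ^ (b + 1)) ℚ_[p]).comp (X + 1)) := by
  have hP : p.Prime := hp.out
  have hirra := irreducible_cyclotomic_comp_X_add_one (p := p) a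
  have hirrb := irreducible_cyclotomic_comp_X_add_one (p := p) b
  rw [hirra.coprime_iff_not_dvd]
  intro hdvd
  have hassoc := (hirra.dvd_irreducible_iff_associated hirrb).mp hdvd
  have hmona : ((cyclotomic (p ^ (a + 1)) ℚ_[p]).comp (X + 1)).Monic := by
    rw [show (X + 1 : ℚ_[p][X]) = X + C 1 by rw [C_1]]
    exact (cyclotomic.monic _ _).comp (monic_X_add_C 1) (by rw [natDegree_X_add_C]; exact one_ne_zero)
  have hmonb : ((cyclotomic (p ^ (b + 1)) ℚ_[p]).comp (X + 1)).Monic := by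
    rw [show (X + 1 : ℚ_[p][X]) = X + C 1 by rw [C_1]]
    exact (cyclotomic.monic _ _).comp (monic_X_add_C 1) (by rw [natDegree_X_add_C]; exact one_ne_zero)
  have heq := eq_of_monic_of_associated hmona hmonb hassoc
  have hdeg := congr_arg natDegree heq
  rw [natDegree_cyclotomic_comp_X_add_one, natDegree_cyclotomic_comp_X_add_one,
    Nat.totient_prime_pow_succ hP, Nat.totient_prime_pow_succ hP] at hdeg
  have h1 : p ^ a = p ^ b := Nat.eq_of_mul_eq_mul_right (Nat.sub_pos_of_lt hP.one_lt) hdeg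
  exact hab (Nat.pow_right_injective hP.two_le h1)

/-- If `X^r ∣ Q` and `Φ_{pⁿ⁺¹}(X+1) ∣ Q` for every `n ∈ S`, then `X^r · ∏_{n∈S} Φ_{pⁿ⁺¹}(X+1) ∣ Q` in
`ℚ_p[X]` (pairwise coprime factors). [folklore] -/
theorem X_pow_mul_prod_cyclotomic_dvd {Q : ℚ_[p][X]} {r : ℕ} (hX : X ^ r ∣ Q) (S : Finset ℕ)
    (hS : ∀ n ∈ S, (cyclotomic (p ^ (n + 1)) ℚ_[p]).comp (X + 1) ∣ Q) :
    X ^ r * ∏ n ∈ S, (cyclotomic (p ^ (n + 1)) ℚ_[p]).comp (X + 1) ∣ Q := by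
  have hprod : ∏ n ∈ S, (cyclotomic (p ^ (n + 1)) ℚ_[p]).comp (X + 1) ∣ Q :=
    Finset.prod_dvd_of_coprime (fun a _ b _ hab ↦ isCoprime_cyclotomic_comp_of_ne hab) hS
  have hcop : IsCoprime (X ^ r : ℚ_[p][X]) (∏ n ∈ S, (cyclotomic (p ^ (n + 1)) ℚ_[p]).comp (X + 1)) :=
    IsCoprime.prod_right fun n _ ↦ (isCoprime_X_cyclotomic_comp n).pow_left
  exact hcop.mul_dvd hX hprod

omit hp in
/-- Degree of `X^r · ∏_{n∈S} Φ_{pⁿ⁺¹}(X+1)`: `r + Σ_{n∈S} φ(pⁿ⁺¹)`. [folklore] -/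
theorem natDegree_X_pow_mul_prod_cyclotomic {R : Type*} [CommRing R] [IsDomain R] (r : ℕ)
    (S : Finset ℕ) :
    (X ^ r * ∏ n ∈ S, (cyclotomic (p ^ (n + 1)) R).comp (X + 1)).natDegree =
      r + ∑ n ∈ S, Nat.totient (p ^ (n + 1)) := by
  have hmon : ∀ n ∈ S, ((cyclotomic (p ^ (n + 1)) R).comp (X + 1)).Monic := fun n _ ↦ by
    rw [show (X + 1 : R[X]) = X + C 1 by rw [C_1]]
    exact (cyclotomic.monic _ _).comp (monic_X_add_C 1) (by rw [natDegree_X_add_C]; exact one_ne_zero)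
  rw [natDegree_mul (pow_ne_zero _ X_ne_zero) (monic_prod_of_monic _ _ hmon).ne_zero, natDegree_pow,
    natDegree_X, mul_one, natDegree_prod_of_monic _ _ hmon]
  exact congr_arg _ (Finset.sum_congr rfl fun n _ ↦ natDegree_cyclotomic_comp_X_add_one _)

omit hp in
/-- `X^r · ∏_{n∈S} Φ_{pⁿ⁺¹}(X+1)` is monic. [folklore] -/
theorem monic_X_pow_mul_prod_cyclotomic {R : Type*} [CommRing R] [IsDomain R] (r : ℕ) (S : Finset ℕ) :
    (X ^ r * ∏ n ∈ S, (cyclotomic (p ^ (n + 1)) R).comp (X + 1)).Monic := by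
  have hmon : ∀ n ∈ S, ((cyclotomic (p ^ (n + 1)) R).comp (X + 1)).Monic := fun n _ ↦ by
    rw [show (X + 1 : R[X]) = X + C 1 by rw [C_1]]
    exact (cyclotomic.monic _ _).comp (monic_X_add_C 1) (by rw [natDegree_X_add_C]; exact one_ne_zero)
  exact (monic_X_pow r).mul (monic_prod_of_monic _ _ hmon)

end Coprime

/-! ## §2. Budget zero: the distinguished polynomial is `X^r · ∏ Φ_{pⁿ⁺¹}(X+1)` -/

section Exact

/-- `T^r ∣ G = p^m · P · U` ⇒ `X^r ∣ P` (as polynomials over `ℤ_p`): divide the unit `U` and the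
non-zero-divisor `p^m` out coefficientwise. [cite: Washington1997, §7.1–7.2 and Thm. 7.3] -/
theorem X_pow_dvd_weierstrassDistinguished {G G' : IwasawaAlgebra p} {m : ℕ}
    (hGG' : G = PowerSeries.C ((p : ℤ_[p]) ^ m) * G')
    (hG' : G'.map (IsLocalRing.residue ℤ_[p]) ≠ 0) {r : ℕ}
    (hX : (PowerSeries.X : IwasawaAlgebra p) ^ r ∣ G) :
    (X : ℤ_[p][X]) ^ r ∣ G'.weierstrassDistinguished hG' := by
  set P : Polynomial ℤ_[p] := G'.weierstrassDistinguished hG' with hP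
  set U : PowerSeries ℤ_[p] := G'.weierstrassUnit hG' with hU
  have hfac : G' = (P : PowerSeries ℤ_[p]) * U := G'.eq_weierstrassDistinguished_mul_weierstrassUnit hG'
  obtain ⟨V, hUV⟩ := (G'.isUnit_weierstrassUnit hG').exists_right_inv
  -- `T^r ∣ G'`: `G = C(p^m) G'`, and `C (p^m)` is cancellable coefficientwise
  have hX' : (PowerSeries.X : IwasawaAlgebra p) ^ r ∣ G' := by
    rw [PowerSeries.X_pow_dvd_iff] at hX ⊢
    intro k hk
    have h := hX k hk
    rw [hGG', PowerSeries.coeff_C_mul, mul_eq_zero] at h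
    exact h.resolve_left (pow_ne_zero _ (Nat.cast_ne_zero.mpr hp.out.ne_zero))
  -- `T^r ∣ P = G' V`
  have hXP : (PowerSeries.X : IwasawaAlgebra p) ^ r ∣ (P : PowerSeries ℤ_[p]) := by
    have : (P : PowerSeries ℤ_[p]) = G' * V := by rw [hfac, mul_assoc, hUV, mul_one]
    rw [this]; exact dvd_mul_of_dvd_left hX' V
  rw [Polynomial.X_pow_dvd_iff]
  intro d hd
  have h := (PowerSeries.X_pow_dvd_iff.mp hXP) d hd
  rwa [Polynomial.coeff_coe] at h

/-- **Budget zero ⇒ the distinguished polynomial is `X^r · ∏_{n∈S} Φ_{pⁿ⁺¹}(X+1)`.** For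
`G = p^m · G'`, `G' ≢ 0 (mod p)`, `P` the distinguished polynomial of `G'`: if `T^r ∣ G`, `G`
vanishes at some `ζ_n − 1` (`ζ_n` of order `pⁿ⁺¹`) for every `n ∈ S`, and
`λ(G) = r + Σ_{n∈S} φ(pⁿ⁺¹)`, then `P = X^r · ∏_{n∈S} Φ_{pⁿ⁺¹}(X+1)` (the product divides `P` in `ℚ_p[X]`
by §1 and both are monic of degree `λ(G)`). [cite: Washington1997, §7.1–7.2 and Thm. 7.3] -/
theorem weierstrassDistinguished_eq_of_lam_eq {G G' : IwasawaAlgebra p} {m : ℕ}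
    (hGG' : G = PowerSeries.C ((p : ℤ_[p]) ^ m) * G')
    (hG' : G'.map (IsLocalRing.residue ℤ_[p]) ≠ 0) {r : ℕ}
    (hX : (PowerSeries.X : IwasawaAlgebra p) ^ r ∣ G) (S : Finset ℕ)
    (hS : ∀ n ∈ S, ∃ ζ : ℂ_[p], IsPrimitiveRoot ζ (p ^ (n + 1)) ∧
      HasSum (fun k ↦ ((algebraMap ℚ_[p] ℂ_[p]).comp (algebraMap ℤ_[p] ℚ_[p]))
        (PowerSeries.coeff k G) * (ζ - 1) ^ k) 0)
    (hlam : lam G = r + ∑ n ∈ S, Nat.totient (p ^ (n + 1))) :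
    G'.weierstrassDistinguished hG' = X ^ r * ∏ n ∈ S, (cyclotomic (p ^ (n + 1)) ℤ_[p]).comp (X + 1) := by
  set P : Polynomial ℤ_[p] := G'.weierstrassDistinguished hG' with hP
  have hPmon : P.Monic := (G'.isDistinguishedAt_weierstrassDistinguished hG').monic
  set Q : ℤ_[p][X] := X ^ r * ∏ n ∈ S, (cyclotomic (p ^ (n + 1)) ℤ_[p]).comp (X + 1) with hQ
  have hQmon : Q.Monic := monic_X_pow_mul_prod_cyclotomic r S
  -- work in `ℚ_p[X]`
  set ι : ℤ_[p] →+* ℚ_[p] := algebraMap ℤ_[p] ℚ_[p] with hι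
  have hιinj : Function.Injective ι := IsFractionRing.injective ℤ_[p] ℚ_[p]
  have hQmap : Q.map ι = X ^ r * ∏ n ∈ S, (cyclotomic (p ^ (n + 1)) ℚ_[p]).comp (X + 1) := by
    rw [hQ, Polynomial.map_mul, Polynomial.map_pow, map_X, Polynomial.map_prod]
    refine congr_arg _ (Finset.prod_congr rfl fun n _ ↦ ?_)
    rw [map_comp, map_cyclotomic, Polynomial.map_add, map_X, Polynomial.map_one]
  -- each factor divides `P.map ι`
  have hXr : (X : ℚ_[p][X]) ^ r ∣ P.map ι := by
    have h := X_pow_dvd_weierstrassDistinguished hGG' hG' hX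
    simpa using map_dvd (mapRingHom ι) h
  have hΦ : ∀ n ∈ S, (cyclotomic (p ^ (n + 1)) ℚ_[p]).comp (X + 1) ∣ P.map ι := by
    intro n hn
    obtain ⟨ζ, hζ, hsum⟩ := hS n hn
    have hz : ‖ζ - 1‖ < 1 := norm_sub_one_lt_one_of_pow_prime_pow_eq_one (j := n + 1) hζ.pow_eq_one
    exact (eval₂_eq_zero_iff_cyclotomic_comp_dvd hζ P).mp
      ((hasSum_zero_iff_eval₂_weierstrassDistinguished_eq_zero hGG' hG' hz).mp hsum)
  have hdvd : Q.map ι ∣ P.map ι := by rw [hQmap]; exact X_pow_mul_prod_cyclotomic_dvd hXr S hΦ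
  -- degrees agree: `deg P = λ(G) = r + Σ φ = deg Q`
  have hdegP : (P.map ι).natDegree = lam G := by
    rw [natDegree_map_eq_of_injective hιinj, lam_eq_natDegree_weierstrassDistinguished hGG' hG']
  have hdegQ : (Q.map ι).natDegree = r + ∑ n ∈ S, Nat.totient (p ^ (n + 1)) := by
    rw [hQmap, natDegree_X_pow_mul_prod_cyclotomic]
  have heq : P.map ι = Q.map ι :=
    eq_of_monic_of_dvd_of_natDegree_le (hQmon.map ι) (hPmon.map ι) hdvd (by rw [hdegP, hdegQ, hlam])
  exact Polynomial.map_injective ι hιinj heq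

/-- **Budget zero ⇒ `G = p^m · (X^r ∏_{n∈S} Φ_{pⁿ⁺¹}(X+1)) · U`** with `U = weierstrassUnit` a unit of
`Λ`: the element is determined by `(m, r, S)` up to a unit. [cite: Washington1997, §7.1–7.2 and Thm. 7.3] -/
theorem eq_C_mul_prod_mul_weierstrassUnit_of_lam_eq {G G' : IwasawaAlgebra p} {m : ℕ}
    (hGG' : G = PowerSeries.C ((p : ℤ_[p]) ^ m) * G')
    (hG' : G'.map (IsLocalRing.residue ℤ_[p]) ≠ 0) {r : ℕ}
    (hX : (PowerSeries.X : IwasawaAlgebra p) ^ r ∣ G) (S : Finset ℕ)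
    (hS : ∀ n ∈ S, ∃ ζ : ℂ_[p], IsPrimitiveRoot ζ (p ^ (n + 1)) ∧
      HasSum (fun k ↦ ((algebraMap ℚ_[p] ℂ_[p]).comp (algebraMap ℤ_[p] ℚ_[p]))
        (PowerSeries.coeff k G) * (ζ - 1) ^ k) 0)
    (hlam : lam G = r + ∑ n ∈ S, Nat.totient (p ^ (n + 1))) :
    G = PowerSeries.C ((p : ℤ_[p]) ^ m) *
      (((X ^ r * ∏ n ∈ S, (cyclotomic (p ^ (n + 1)) ℤ_[p]).comp (X + 1) : ℤ_[p][X]) :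
        PowerSeries ℤ_[p]) * G'.weierstrassUnit hG') ∧ IsUnit (G'.weierstrassUnit hG') := by
  refine ⟨?_, G'.isUnit_weierstrassUnit hG'⟩
  rw [← weierstrassDistinguished_eq_of_lam_eq hGG' hG' hX S hS hlam,
    ← G'.eq_weierstrassDistinguished_mul_weierstrassUnit hG']
  exact hGG'

/-- **Budget zero ⇒ the zero set is exactly known**: under the same hypotheses, for `|z| < 1`,
`G(z) = 0 ↔ (r ≠ 0 ∧ z = 0) ∨ ∃ n ∈ S, (1 + z)` is a primitive `pⁿ⁺¹`-th root of unity.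
[cite: Washington1997, §7.1–7.2 and Thm. 7.3] -/
theorem hasSum_zero_iff_of_lam_eq {G G' : IwasawaAlgebra p} {m : ℕ}
    (hGG' : G = PowerSeries.C ((p : ℤ_[p]) ^ m) * G')
    (hG' : G'.map (IsLocalRing.residue ℤ_[p]) ≠ 0) {r : ℕ}
    (hX : (PowerSeries.X : IwasawaAlgebra p) ^ r ∣ G) (S : Finset ℕ)
    (hS : ∀ n ∈ S, ∃ ζ : ℂ_[p], IsPrimitiveRoot ζ (p ^ (n + 1)) ∧
      HasSum (fun k ↦ ((algebraMap ℚ_[p] ℂ_[p]).comp (algebraMap ℤ_[p] ℚ_[p]))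
        (PowerSeries.coeff k G) * (ζ - 1) ^ k) 0)
    (hlam : lam G = r + ∑ n ∈ S, Nat.totient (p ^ (n + 1))) {z : ℂ_[p]} (hz : ‖z‖ < 1) :
    HasSum (fun k ↦ ((algebraMap ℚ_[p] ℂ_[p]).comp (algebraMap ℤ_[p] ℚ_[p]))
        (PowerSeries.coeff k G) * z ^ k) 0 ↔
      (r ≠ 0 ∧ z = 0) ∨ ∃ n ∈ S, IsPrimitiveRoot (1 + z) (p ^ (n + 1)) := by
  have hP : p.Prime := hp.out
  set ιZ : ℤ_[p] →+* ℂ_[p] := (algebraMap ℚ_[p] ℂ_[p]).comp (algebraMap ℤ_[p] ℚ_[p]) with hιZ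
  rw [hasSum_zero_iff_eval₂_weierstrassDistinguished_eq_zero hGG' hG' hz,
    weierstrassDistinguished_eq_of_lam_eq hGG' hG' hX S hS hlam, eval₂_mul, eval₂_pow, eval₂_X,
    eval₂_finsetProd, mul_eq_zero, Finset.prod_eq_zero_iff]
  refine or_congr (pow_eq_zero_iff'.trans And.comm) (exists_congr fun n ↦ and_congr_right fun _ ↦ ?_)
  haveI : NeZero ((p ^ (n + 1) : ℕ) : ℂ_[p]) := ⟨Nat.cast_ne_zero.mpr (pow_ne_zero _ hP.ne_zero)⟩
  rw [eval₂_comp, eval₂_add, eval₂_X, eval₂_one, eval₂_eq_eval_map, map_cyclotomic, ← IsRoot.def,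
    isRoot_cyclotomic_iff, add_comm]

end Exact

end Summit.BirchSwinnertonDyer.Rank1Residual.Iwasawa

end
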